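import Mathlib
import Summits.PneNP.PneNP.Theses.RamseyUncertifiable
import Summits.PneNP.PneNP.Theorems.RamseyNotNP.Negative.Sandwich
import Literature.Computability.MetaComplexity.ProofSystems
import Literature.Computability.MetaComplexity.ProofSystemsProofs

/-!
# Crux-triage r2 (triager 1) — kernel-checked evidence on the card `optimality-cut` (crux stmt-PneNP-9814)

Definitions `ramseyLang`, `Hard`, `Opt`, `OptFam`, `FCT` and the lemmas `ramseyNotNP_of_hard_opt`,
`hard_of_ramseyNotNP`, `opt_of_isPolyBounded`, `fct_of_opt` are copied VERBATIM from the ideator's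
`Cruxes/RamseyNotNP/SketchIdeator5.lean` (Cruxes modules are not importable), so that the triage
findings below are statements about exactly the card's objects.

Findings (all sorry-free):
* `stubs_iff`       — the line's stub set `{Hard Q, Opt Q}` is logically `{X, Opt Q}`: X plus an extra obligation.
* `hard_or_opt`     — `Hard Q ∨ Opt Q` holds for EVERY Ramsey certifier: the cut is the vacuous case split.
* `fct_iff_glue`    — the thesis `FCT Q` is literally the glue implication `Hard Q → X`; `Opt → FCT` and the
                      cut factors through it, so the load-bearing instance of the thesis IS "Hard → X".
* `opt_carries_X_of_hard`, `coNP_ne_NP_of_opt_of_hard` — once `Hard Q` is a theorem (e.g. `Q` := resolution on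
                      LPRT's binary Ramsey CNF, arXiv:1303.3166 Thm 3), the thesis stub ALONE implies X and
                      `coNP ≠ NP`: objection O1 of `Lines/Sketch-dead.md` bites at `stub_opt`.
* `npImmune_of_optFam_of_nowhereEasy` — at the bottom of the dial (a certifier that is nowhere polynomially
                      bounded, LPRT shape) the instance-form thesis `OptFam Q` is NP-IMMUNITY of RAMSEY₂, the apex
                      Disproof.lean §7 tells planners not to use.
-/

set_option linter.dupNamespace false

namespace Summit.PneNP.PneNP.Cruxes.RamseyNotNP.Triage2r2

open Literature.Computability.Complexity Literature.Computability.Complexity.Nondeterministic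
open Literature.Computability.MetaComplexity
open Summit.PneNP.PneNP.Theses.RamseyUncertifiable

/-! ## Copied verbatim from SketchIdeator5.lean -/

/-- RAMSEY₂ as a language of adjacency codes (the crux's set-builder, verbatim). -/
def ramseyLang : Language Bool :=
  encodingGraph.toLanguage {p : Σ n, SimpleGraph (Fin n) |
    p.2.CliqueFree (Nat.clog 2 (p.1 ^ 2)) ∧ p.2ᶜ.CliqueFree (Nat.clog 2 (p.1 ^ 2))}

theorem ramseyNotNP_iff : RamseyNotNP ↔ ramseyLang ∉ NP := Iff.rfl

def Hard (Q : List Bool → List Bool → Bool) : Prop := ¬ IsPolyBounded Q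

def Opt (Q : List Bool → List Bool → Bool) : Prop :=
  ∀ W, IsProofSystemFor W ramseyLang → Simulates Q W

def OptFam (Q : List Bool → List Bool → Bool) : Prop :=
  ∀ F : Language Bool, F ∈ NP → F ≤ ramseyLang →
    ∃ p : Polynomial ℕ, ∀ x ∈ F, ∃ π : List Bool, π.length ≤ p.eval x.length ∧ Q x π = true

def FCT (Q : List Bool → List Bool → Bool) : Prop := ramseyLang ∈ NP → IsPolyBounded Q

theorem ramseyNotNP_of_hard_opt {Q : List Bool → List Bool → Bool}
    (hQ : IsProofSystemFor Q ramseyLang) (hH : Hard Q) (hO : Opt Q) : RamseyNotNP := by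
  intro hNP
  obtain ⟨W, hW, hWb⟩ := (hasPolyBoundedProofSystem_iff_mem_NP_holds (L := ramseyLang)).2 hNP
  exact hH (IsPolyBounded.of_simulates_holds (hO W hW) hWb hQ hW)

theorem hard_of_ramseyNotNP (hX : RamseyNotNP) {Q : List Bool → List Bool → Bool}
    (hQ : IsProofSystemFor Q ramseyLang) : Hard Q :=
  fun hb => hX ((hasPolyBoundedProofSystem_iff_mem_NP_holds (L := ramseyLang)).1 ⟨Q, hQ, hb⟩)

private theorem eval_mono (r : Polynomial ℕ) {a b : ℕ} (hab : a ≤ b) : r.eval a ≤ r.eval b := by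
  rw [Polynomial.eval_eq_sum_range, Polynomial.eval_eq_sum_range]
  exact Finset.sum_le_sum fun i _ => Nat.mul_le_mul_left _ (Nat.pow_le_pow_left hab i)

theorem opt_of_isPolyBounded {Q : List Bool → List Bool → Bool}
    (hQ : IsProofSystemFor Q ramseyLang) (hb : IsPolyBounded Q) : Opt Q := by
  intro W hW
  obtain ⟨p, hp⟩ := hb
  refine ⟨p, fun x π hπ => ?_⟩
  have hx : x ∈ ramseyLang := (hW.2 x).2 ⟨π, hπ⟩
  obtain ⟨π₀, hπ₀⟩ := (hQ.2 x).1 hx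
  obtain ⟨π', hlen, hacc⟩ := hp x π₀ hπ₀
  exact ⟨π', hlen.trans (eval_mono p (Nat.le_add_right _ _)), hacc⟩

theorem fct_of_opt {Q : List Bool → List Bool → Bool}
    (hQ : IsProofSystemFor Q ramseyLang) (hO : Opt Q) : FCT Q := by
  intro hNP
  obtain ⟨W, hW, hWb⟩ := (hasPolyBoundedProofSystem_iff_mem_NP_holds (L := ramseyLang)).2 hNP
  exact IsPolyBounded.of_simulates_holds (hO W hW) hWb hQ hW

/-! ## Triage findings -/

/-- **(a) The stub set is X plus an extra obligation.** For any Ramsey certifier `Q`,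
`Hard Q ∧ Opt Q ↔ RamseyNotNP ∧ Opt Q`: whoever closes the line's two stubs has proved the crux
AND the optimality thesis; nothing weaker than X is ever the target. -/
theorem stubs_iff {Q : List Bool → List Bool → Bool} (hQ : IsProofSystemFor Q ramseyLang) :
    (Hard Q ∧ Opt Q) ↔ (RamseyNotNP ∧ Opt Q) :=
  ⟨fun h => ⟨ramseyNotNP_of_hard_opt hQ h.1 h.2, h.2⟩, fun h => ⟨hard_of_ramseyNotNP h.1 hQ, h.2⟩⟩

/-- **(b) The vacuous case split.** `Hard Q ∨ Opt Q` holds for every Ramsey certifier, unconditionally: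
one of the two stubs is always free, and the conjunction is `X ∧ Opt Q` (a). -/
theorem hard_or_opt {Q : List Bool → List Bool → Bool} (hQ : IsProofSystemFor Q ramseyLang) :
    Hard Q ∨ Opt Q := by
  by_cases hb : IsPolyBounded Q
  · exact Or.inr (opt_of_isPolyBounded hQ hb)
  · exact Or.inl hb

/-- **(c) The thesis IS the glue.** `FCT Q ↔ (Hard Q → RamseyNotNP)`; since `Opt Q → FCT Q`
(`fct_of_opt`) and the cut `ramseyNotNP_of_hard_opt` uses `Opt` only to obtain `FCT`, the part of the
thesis the line consumes is literally the implication from the other stub to the crux. -/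
theorem fct_iff_glue (Q : List Bool → List Bool → Bool) : FCT Q ↔ (Hard Q → RamseyNotNP) := by
  unfold FCT Hard
  rw [ramseyNotNP_iff]
  constructor
  · exact fun h hH hNP => hH (h hNP)
  · intro h hNP
    by_contra hb
    exact h hb hNP

/-- The cut factors through the thesis: `Opt` is used only as `FCT`. -/
theorem ramseyNotNP_of_hard_fct {Q : List Bool → List Bool → Bool}
    (hH : Hard Q) (hF : FCT Q) : RamseyNotNP :=
  (fct_iff_glue Q).1 hF hH

/-- **(d) O1 bites at the thesis stub as soon as `Hard Q` is a theorem.** With `Hard Q` proved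
(e.g. `Q` := resolution on the binary Ramsey CNF, where non-p-boundedness on EVERY Ramsey graph is
Lauria–Pudlák–Rödl–Thapen's theorem, arXiv:1303.3166 Thm 3), `Opt Q` alone implies the crux … -/
theorem opt_carries_X_of_hard {Q : List Bool → List Bool → Bool} (hQ : IsProofSystemFor Q ramseyLang)
    (hH : Hard Q) : Opt Q → RamseyNotNP :=
  fun hO => ramseyNotNP_of_hard_opt hQ hH hO

/-- … and hence `coNP ≠ NP` (landed `Negative.coNP_ne_NP_of_ramseyNotNP`): the `line_closure_proves_coNP_ne_NP`
meta-fact of `Lines/Sketch-dead.md` applied with `D := Opt Q`. -/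
theorem coNP_ne_NP_of_opt_of_hard {Q : List Bool → List Bool → Bool} (hQ : IsProofSystemFor Q ramseyLang)
    (hH : Hard Q) (hO : Opt Q) : coNP ≠ NP :=
  Summit.PneNP.PneNP.Theorems.RamseyNotNP.Negative.coNP_ne_NP_of_ramseyNotNP (ramseyNotNP_of_hard_opt hQ hH hO)

/-- `NowhereEasy Q` (the LPRT shape of a hardness theorem, e.g. resolution on binary Ramsey formulas:
for every polynomial `p` only finitely many inputs have `Q`-proofs of length `≤ p |x|`). -/
def NowhereEasy (Q : List Bool → List Bool → Bool) : Prop :=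
  ∀ p : Polynomial ℕ, {x : List Bool | ∃ π : List Bool, π.length ≤ p.eval x.length ∧ Q x π = true}.Finite

/-- **(e) Bottom of the dial = the immunity apex.** For a nowhere-easy certifier `Q` (resolution, by
LPRT), the instance-form thesis `OptFam Q` says every `NP` family of Ramsey codes is FINITE — with the
landed infinitude of RAMSEY₂ this is `RamseyNPImmuneAt thr` of Disproof.lean §7, the strengthening of X
that §7 warns planners not to use (its negation is an NP-certified infinite family of threshold-Ramsey
graphs — Erdős' explicit-construction corner). -/
theorem np_families_finite_of_optFam_of_nowhereEasy {Q : List Bool → List Bool → Bool}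
    (hO : OptFam Q) (hN : NowhereEasy Q) :
    ∀ F : Language Bool, F ∈ NP → F ≤ ramseyLang → (F : Set (List Bool)).Finite := by
  intro F hF hsub
  obtain ⟨p, hp⟩ := hO F hF hsub
  exact (hN p).subset fun x hx => hp x hx

/-- In particular a nowhere-easy `Q` with `OptFam Q` forces the crux outright (no `Hard` stub needed:
it is built into `NowhereEasy`), through NP-immunity: the thesis conjunct is then `≥ X` on its own. -/
theorem ramseyNotNP_of_optFam_of_nowhereEasy {Q : List Bool → List Bool → Bool}
    (hO : OptFam Q) (hN : NowhereEasy Q)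
    (hinf : (ramseyLang : Set (List Bool)).Infinite) : RamseyNotNP :=
  fun hNP => hinf (np_families_finite_of_optFam_of_nowhereEasy hO hN ramseyLang hNP le_rfl)

end Summit.PneNP.PneNP.Cruxes.RamseyNotNP.Triage2r2
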